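import Summits.BirchSwinnertonDyer.Rank1Residual.X12.O11.RamifiedEllipticUnitMechanism
import Summits.BirchSwinnertonDyer.Rank1Residual.X12.CMSevenAwayFromSeven
import HarnessLib

set_option linter.dupNamespace false

/-!
# Route `RamifiedSevenEllipticUnits` (rung K7r): Theorems-side BRIDGE to the O11 elliptic-unit mechanism
# (rev-8, planner D102/D110/D112; J 2026-08-26T07:36:48Z checklist (2)) — imported BY the route file

Cell `bsd-cm`, seat `bsd-cm-k7r-c4` (g4). HONEST FRAMING: nothing here closes an item; BSD is not proved
by any of this. Route files import only `Summits.BirchSwinnertonDyer.BirchSwinnertonDyer.Theorems.*` (D66)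
and are imported by every other K7r Theorems file, so THIS file imports NO `Theses` module (no cycle) and
states everything over the BODIES of the rev-8 items, `CMRungInputs`-style: the rev-8 items
`EllipticUnitIMCSeven` (support, cite-level: ∀ W ∈ 𝒞₇, `O11.RamifiedCMEllipticUnitIMCAt W 7`,
the ∃-form (R-IMC)∃; planner D112) and `EllipticUnitValueSeven` (crux, attacked: ∀ W ∈ 𝒞₇,
`O11.RamifiedCMBottomClassIndexLawAt W 7`) reach the O11 module `X12/O11/RamifiedEllipticUnitMechanism.lean`
through this file, and the gate glue `EllipticUnitIndexSevenGlue : EllipticUnitIMCSeven →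
EllipticUnitValueSeven → EllipticUnitIndexSeven` closes by
`fun h₁ h₂ => EllipticUnitMechanismBridge.ellipticUnitIndexAt_seven_of_imc_of_value h₁ h₂` (definitional
unfolding of the three route defs).

HONEST T1 READING (planner D112 (b), verbatim): «Value ⟺ 19143 modulo {IMC∃, (R-tors)} ⟺ BSD₇ on 𝒞₇
modulo print (p439069/p431947); the split is a BRIDGE split of 19143 with T = IMC∃ SUBSTANTIVE-in-print
(human BC2 ruling: «T must not give S alone AND T must be substantive»; both hold: probe IMC∃ → leaf
fails, IMC is Rubin 1991 + BKNO 2026), seam trivial by design (`trivial_seam` flag declared, not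
hidden); it RELOCATES the open content (the ramified value formula (★_an)) onto one correctly-labelled
item, it does not weaken it; K7r's disposition may stay FRONTIER — that is the tribunal's call, not
claimed here.» BRIDGE split, T = (R-IMC)∃.

* `ellipticUnitIndexAt_seven_of_imc_of_value` — IMC piece → VALUE piece → (R-EU)@7 on 𝒞₇ (bodies);
* `value_seven_of_ellipticUnitIndexAt` — converse modulo (R-tors)@7 on 𝒞₇ only (BC2 «no weakening»; no IMC piece needed in this direction).

References: [BurungaleKobayashiNakamuraOta2026] §3, Thm. 3.14 (3), Thm. 7.2, §1.4 (arXiv:2608.06879; shape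
only); [Rubin1991MainConj] Thm. 4.1; [Miller2011LMS] Def. 1.1.
-/

noncomputable section

open scoped Classical

open WeierstrassCurve NumberField IsDedekindDomain
  Literature.NumberTheory.EllipticCurves
  Literature.NumberTheory.EllipticCurves.Rank1Residual

namespace Summit.BirchSwinnertonDyer.BirchSwinnertonDyer.Rank1Residual.EllipticUnitMechanismBridge

open Summit.BirchSwinnertonDyer.Rank1Residual Summit.BirchSwinnertonDyer.Rank1Residual.X12.O11

/-- **IMC piece → VALUE piece → (R-EU)@7 on 𝒞₇** — the rev-8 glue over the item BODIES (the conclusion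
is literally the body of the route item `EllipticUnitIndexSeven`, so the gate glue
`EllipticUnitIndexSevenGlue` closes by `fun h₁ h₂ => ellipticUnitIndexAt_seven_of_imc_of_value h₁ h₂`):
for every global minimal `W ∈ 𝒞₇`, (R-IMC)∃@7 and the relative law (R-PR)|IMC@7 give (R-EU)@7 by the
O11 seam `ramifiedCMEllipticUnitIndexAt_of_imc_of_indexLaw` (planner D112 (c): the children are `∀ W ∈ 𝒞₇, O11.RamifiedCMEllipticUnitIMCAt W 7` (support) and
`∀ W ∈ 𝒞₇, O11.RamifiedCMBottomClassIndexLawAt W 7` (crux); existence is implied by the former).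
[cite: Miller2011LMS, Def. 1.1] [cite: BurungaleKobayashiNakamuraOta2026, Thm. 3.14 (3) and §1.4 (arXiv:2608.06879; shape only)] -/
theorem ellipticUnitIndexAt_seven_of_imc_of_value
    (h₁ : ∀ (W : WeierstrassCurve ℚ) [W.IsElliptic] [W.IsGloballyMinimal] [Fact (Nat.Prime 7)],
      X12.ClassCSeven W → RamifiedCMEllipticUnitIMCAt W 7)
    (h₂ : ∀ (W : WeierstrassCurve ℚ) [W.IsElliptic] [W.IsGloballyMinimal] [Fact (Nat.Prime 7)],
      X12.ClassCSeven W → RamifiedCMBottomClassIndexLawAt W 7) :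
    ∀ (W : WeierstrassCurve ℚ) [W.IsElliptic] [W.IsGloballyMinimal] [Fact (Nat.Prime 7)],
      X12.ClassCSeven W → RamifiedCMEllipticUnitIndexAt W 7 :=
  fun W _ _ _ hC => ramifiedCMEllipticUnitIndexAt_of_imc_of_indexLaw (h₁ W hC) (h₂ W hC)

/-- **Converse (BC2 «no weakening»)**: (R-EU)@7 on 𝒞₇ gives the VALUE piece back, granted only
(R-tors)@7 on 𝒞₇ (the body of `StrictTorsionSeven`; a theorem under GZK, k7r-c4 p430232) — no IMC piece
is needed in this direction. [cite: Miller2011LMS, Def. 1.1] -/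
theorem value_seven_of_ellipticUnitIndexAt
    (h₂ : ∀ (W : WeierstrassCurve ℚ) [W.IsElliptic] [W.IsGloballyMinimal] [Fact (Nat.Prime 7)],
      X12.ClassCSeven W → RamifiedCMStrictTorsionAt W 7)
    (h : ∀ (W : WeierstrassCurve ℚ) [W.IsElliptic] [W.IsGloballyMinimal] [Fact (Nat.Prime 7)],
      X12.ClassCSeven W → RamifiedCMEllipticUnitIndexAt W 7) :
    ∀ (W : WeierstrassCurve ℚ) [W.IsElliptic] [W.IsGloballyMinimal] [Fact (Nat.Prime 7)],
      X12.ClassCSeven W → RamifiedCMBottomClassIndexLawAt W 7 :=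
  fun W _ _ _ hC => ramifiedCMBottomClassIndexLawAt_of_indexAt (h W hC) (h₂ W hC)

end Summit.BirchSwinnertonDyer.BirchSwinnertonDyer.Rank1Residual.EllipticUnitMechanismBridge

end
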